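import Summits.CriticalPhenomena.Ising3DConformalLimit.Theorems.GapForcesFarMerging.Negative.SoftKernel
import Literature.Probability.LatticeModels.CriticalTwoPointBounds
import Literature.Probability.LatticeModels.TwoPointSupNormMonotone
import Literature.Probability.LatticeModels.ImprovedTreeDiagramBoundProofs
import Literature.Probability.LatticeModels.IsingFKG
import Literature.Probability.LatticeModels.PlusStateFKG
import Literature.Probability.LatticeModels.GKSInequalities
import Literature.Probability.LatticeModels.GriffithsMonotonicity

/-!
# `GapForcesFarMerging` is not soft, V: the soft package is Ising-true (certificate from the tree)

Part 5 — every field of `SoftPackage` (Part 1, `SoftShapes`) except bubble divergence is a THEOREM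
of the tree for the critical correlators `(cc2, criticalTwoPoint 3, criticalCorr 3 4)` of the
nearest-neighbour Ising model on `ℤ³` (`softPackageNoBubble_criticalCorr`): pair symmetry and
translation invariance (`criticalCorr_two_pair`), hyperoctahedral invariance
(`twoPointPlus_perm_invariant_holds`, `twoPointPlus_reflection_invariant_holds`), `⟨σ₀σ₀⟩ = 1`,
positivity and the `ℤ³` bounds (`criticalTwoPoint_bounds_holds`), `⟨σσ⟩ ≤ 1`, Messager–Miracle-Solé
in the sup norm (`twoPointPlus_le_of_mul_supNorm_le`, ADC21 (5.3)), GKS II on pairs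
(`twoPointPlus_mul_le_twoPointPlus`), permutation symmetry / translation invariance
(`plusExpect_spinProduct_comp_shift` + `ising_fkg_holds`) / `σ² = 1` consistency / GKS I
(`plusCorr_nonneg`) / GKS II with multiplicities (`plusCorr_mul_le`) of the four-point function,
Lebowitz (`criticalUrsellFour_nonpos`) and Aizenman's bound (`abs_criticalUrsellFour_le_two_mul`).
Bubble divergence `Σ_x⟨σ₀σ_x⟩² = ∞` is Duminil-Copin–Panis 2025, Thm 1.8 (in the tree only inside
the named fact `LaceExpansionIsingAboveFourNarrow`); `softPackage_iff_noBubble_and_bubble`.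
Consequently the no-go theorems of Part 4 quantify over a class that provably contains the critical
Ising correlators of `ℤ³` up to one printed theorem.

Split of the standing adversary's work file
`Summits/CriticalPhenomena/Ising3DConformalLimit/Cruxes/GapForcesFarMerging/Disproof.lean` (§6),
crux `stmt-CriticalPhenomena-4468`, route `EnergyNotSigmaSquared`.

## References

* S. Friedli, Y. Velenik, *Statistical Mechanics of Lattice Systems* (CUP 2017), Thm 3.17, Thm 3.20
  [FriedliVelenik2017].
* M. Aizenman, H. Duminil-Copin, Ann. Math. 194 (2021), eqs. (3.12), (5.3)
  [AizenmanDuminilCopinAnnals2021].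
* J. L. Lebowitz, Comm. Math. Phys. 35 (1974) 87–92 [Lebowitz1974].
* H. Duminil-Copin, R. Panis, arXiv:2404.05700, Thm 1.8 [DuminilCopinPanis2025LowerBounds].
-/

noncomputable section

namespace Summit.CriticalPhenomena.Ising3DConformalLimit.Theorems.GapForcesFarMerging.Negative

open Literature.Probability.LatticeModels
open Summit.CriticalPhenomena.Ising3DConformalLimit.Theses.EnergyNotSigmaSquared

/-- `SoftPackage` without the bubble-divergence field. [folklore] -/
structure SoftPackageNoBubble (S : Site 3 → Site 3 → ℝ) (T : Site 3 → ℝ)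
    (F : (Fin 4 → Site 3) → ℝ) : Prop where
  two : ∀ x, T x = S 0 x
  symm : ∀ a b, S a b = S b a
  transl : ∀ a b v, S (a + v) (b + v) = S a b
  perm : ∀ (π : Equiv.Perm (Fin 3)) (a b : Site 3), S (a ∘ ⇑π) (b ∘ ⇑π) = S a b
  refl : ∀ (k : Fin 3) (a b : Site 3), S (flipAt k a) (flipAt k b) = S a b
  diag : ∀ a, S a a = 1
  pos : ∀ a b, 0 < S a b
  le_one : ∀ a b, S a b ≤ 1
  upper : ∃ C : ℝ, ∀ x : Site 3, x ≠ 0 → S 0 x ≤ C * (‖x‖ : ℝ) ^ (-(1 : ℝ))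
  lower : ∃ c : ℝ, 0 < c ∧ ∀ x : Site 3, x ≠ 0 → c * (‖x‖ : ℝ) ^ (-(2 : ℝ)) ≤ S 0 x
  mms : ∀ v w : Site 3, 3 * ‖v‖ ≤ ‖w‖ → S 0 w ≤ S 0 v
  gks_pair : ∀ a b c, S a b * S b c ≤ S a c
  swap01 : ∀ y, F (y ∘ ⇑(Equiv.swap (0 : Fin 4) 1)) = F y
  swap12 : ∀ y, F (y ∘ ⇑(Equiv.swap (1 : Fin 4) 2)) = F y
  swap23 : ∀ y, F (y ∘ ⇑(Equiv.swap (2 : Fin 4) 3)) = F y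
  translF : ∀ y v, F (fun i => y i + v) = F y
  coincide : ∀ a x z, F ![a, a, x, z] = S x z
  nonneg : ∀ y, 0 ≤ F y
  griffiths : ∀ y, S (y 0) (y 1) * S (y 2) (y 3) ≤ F y
  lebowitz : ∀ y, F y - (S (y 0) (y 1) * S (y 2) (y 3) + S (y 0) (y 2) * S (y 1) (y 3)
    + S (y 0) (y 3) * S (y 1) (y 2)) ≤ 0
  aizenman : ∀ y, -(2 * (S (y 0) (y 1) * S (y 2) (y 3))) ≤ F y - (S (y 0) (y 1) * S (y 2) (y 3)
    + S (y 0) (y 2) * S (y 1) (y 3) + S (y 0) (y 3) * S (y 1) (y 2))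

/-- `SoftPackage = SoftPackageNoBubble + bubble divergence`. [folklore] -/
theorem softPackage_iff_noBubble_and_bubble (S : Site 3 → Site 3 → ℝ) (T : Site 3 → ℝ)
    (F : (Fin 4 → Site 3) → ℝ) :
    SoftPackage S T F ↔ SoftPackageNoBubble S T F ∧ ¬ Summable (fun x : Site 3 => S 0 x ^ 2) := by
  constructor
  · intro h
    exact ⟨⟨h.two, h.symm, h.transl, h.perm, h.refl, h.diag, h.pos, h.le_one, h.upper, h.lower, h.mms,
      h.gks_pair, h.swap01, h.swap12, h.swap23, h.translF, h.coincide, h.nonneg, h.griffiths,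
      h.lebowitz, h.aizenman⟩, h.bubble⟩
  · rintro ⟨h, hb⟩
    exact ⟨h.two, h.symm, h.transl, h.perm, h.refl, h.diag, h.pos, h.le_one, h.upper, h.lower, h.mms,
      h.gks_pair, hb, h.swap01, h.swap12, h.swap23, h.translF, h.coincide, h.nonneg, h.griffiths,
      h.lebowitz, h.aizenman⟩

/-- Critical correlators are invariant under relabelling the points (the spin monomial is a
commutative product). [folklore] -/
theorem criticalCorr_comp_perm {n : ℕ} (y : Fin n → Site 3) (σ : Equiv.Perm (Fin n)) :
    criticalCorr 3 n (y ∘ ⇑σ) = criticalCorr 3 n y := by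
  show plusExpect 3 (criticalBeta 3) 0 (spinMonomial (y ∘ ⇑σ)) =
    plusExpect 3 (criticalBeta 3) 0 (spinMonomial y)
  congr 1
  funext s
  unfold spinMonomial
  exact Fintype.prod_equiv σ _ _ fun i => rfl

/-- `σ_a² = 1`: `⟨σ_aσ_aσ_xσ_z⟩_{β_c} = ⟨σ_xσ_z⟩_{β_c}`. [cite: FriedliVelenik2017, §3.6.1] -/
theorem criticalCorr_coincide (a x z : Site 3) :
    criticalCorr 3 4 ![a, a, x, z] = criticalCorr 3 2 ![x, z] := by
  show plusExpect 3 (criticalBeta 3) 0 (spinMonomial ![a, a, x, z]) =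
    plusExpect 3 (criticalBeta 3) 0 (spinMonomial ![x, z])
  congr 1
  funext s
  simp only [spinMonomial, Fin.prod_univ_four, Fin.prod_univ_two, Matrix.cons_val_zero,
    Matrix.cons_val_one, Matrix.cons_val]
  have h1 : spinAt a s * spinAt a s = 1 := by
    unfold spinAt
    rw [← Int.cast_mul, ← Units.val_mul, Int.units_mul_self]
    simp
  rw [h1, one_mul]

/-- GKS I in infinite volume: `0 ≤ ⟨∏σ_{yᵢ}⟩_{β_c}`. [cite: FriedliVelenik2017, Thm. 3.20, eq. (3.21), p. 109] -/
theorem criticalCorr_nonneg' {n : ℕ} (y : Fin n → Site 3) : 0 ≤ criticalCorr 3 n y := by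
  classical
  obtain ⟨A, hA⟩ := exists_spinMonomial_eq_spinProduct y
  show 0 ≤ plusExpect 3 (criticalBeta 3) 0 (spinMonomial y)
  rw [hA]
  exact plusCorr_nonneg (criticalBeta_nonneg 3) le_rfl A

/-- Translation invariance of the critical correlators (Friedli–Velenik Thm 3.17, from the tree's
`plusExpect_spinProduct_comp_shift` + `ising_fkg_holds`). [cite: FriedliVelenik2017, Thm. 3.17] -/
theorem criticalCorr_translate {n : ℕ} (y : Fin n → Site 3) (v : Site 3) :
    criticalCorr 3 n (fun i => y i + v) = criticalCorr 3 n y := by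
  classical
  obtain ⟨A, hA⟩ := exists_spinMonomial_eq_spinProduct y
  have hshift : spinMonomial (fun i => y i + v) = spinProduct A ∘ ⇑(configShift (-v)) := by
    funext s
    have h1 : spinMonomial (fun i => y i + v) s =
        spinMonomial y (configShift (-v) s) := by
      simp [spinMonomial, spinAt, sub_neg_eq_add]
    rw [h1, Function.comp_apply, ← hA]
  show plusExpect 3 (criticalBeta 3) 0 (spinMonomial fun i => y i + v) =
    plusExpect 3 (criticalBeta 3) 0 (spinMonomial y)
  rw [hshift, hA]
  exact plusExpect_spinProduct_comp_shift (fun β => ising_fkg_holds (zdGraph 3) (β := β))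
    (criticalBeta_nonneg 3) 0 A (-v)

/-- GKS II in infinite volume with multiplicities: `⟨σ_{y₀}σ_{y₁}⟩⟨σ_{y₂}σ_{y₃}⟩ ≤ ⟨σ_{y₀}σ_{y₁}σ_{y₂}σ_{y₃}⟩`
at `β_c` (coincidences allowed). [cite: FriedliVelenik2017, Thm. 3.20, eq. (3.22), p. 109] -/
theorem criticalCorr_griffiths (y : Fin 4 → Site 3) :
    cc2 (y 0) (y 1) * cc2 (y 2) (y 3) ≤ criticalCorr 3 4 y := by
  classical
  obtain ⟨A, hA⟩ := exists_spinMonomial_eq_spinProduct ![y 0, y 1]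
  obtain ⟨B, hB⟩ := exists_spinMonomial_eq_spinProduct ![y 2, y 3]
  have hy : spinMonomial y = spinProduct (symmDiff A B) := by
    funext s
    have h1 : spinMonomial y s = spinMonomial ![y 0, y 1] s * spinMonomial ![y 2, y 3] s := by
      simp only [spinMonomial, Fin.prod_univ_four, Fin.prod_univ_two, Matrix.cons_val_zero,
        Matrix.cons_val_one]
      ring
    rw [h1, hA, hB, spinProduct_mul_spinProduct]
  show plusExpect 3 (criticalBeta 3) 0 (spinMonomial ![y 0, y 1]) *
      plusExpect 3 (criticalBeta 3) 0 (spinMonomial ![y 2, y 3]) ≤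
    plusExpect 3 (criticalBeta 3) 0 (spinMonomial y)
  rw [hA, hB, hy]
  exact plusCorr_mul_le (criticalBeta_nonneg 3) le_rfl A B

/-- **The soft package, bubble divergence apart, is a theorem for the critical Ising model on
`ℤ³`.** Field by field: `criticalCorr_two`, `criticalCorr_two_pair(_comm)`,
`twoPointPlus_perm_invariant_holds`, `twoPointPlus_reflection_invariant_holds`,
`criticalTwoPoint_zero'`, `criticalTwoPoint_bounds_holds` (`c‖x‖⁻² ≤ G ≤ C‖x‖⁻¹`, and positivity),
`criticalTwoPoint_le_one'`, `twoPointPlus_le_of_mul_supNorm_le` (MMS in the sup norm, ADC21 (5.3)),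
`twoPointPlus_mul_le_twoPointPlus` (GKS II on pairs), `criticalCorr_comp_perm`,
`criticalCorr_translate`, `criticalCorr_coincide`, `criticalCorr_nonneg'`, `criticalCorr_griffiths`,
`criticalUrsellFour_nonpos` (Lebowitz), `abs_criticalUrsellFour_le_two_mul` (Aizenman).
[cite: AizenmanDuminilCopinAnnals2021, eq. (3.12) and (5.3)] -/
theorem softPackageNoBubble_criticalCorr :
    SoftPackageNoBubble cc2 (criticalTwoPoint 3) (criticalCorr 3 4) where
  two x := (criticalCorr_two 3 x).symm
  symm a b := criticalCorr_two_pair_comm a b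
  transl a b v := by
    show criticalCorr 3 2 ![a + v, b + v] = criticalCorr 3 2 ![a, b]
    rw [criticalCorr_two_pair, criticalCorr_two_pair, add_sub_add_right_eq_sub]
  perm π a b := by
    show criticalCorr 3 2 ![a ∘ ⇑π, b ∘ ⇑π] = criticalCorr 3 2 ![a, b]
    rw [criticalCorr_two_pair, criticalCorr_two_pair]
    exact twoPointPlus_perm_invariant_holds (criticalBeta_nonneg 3) π (b - a)
  refl k a b := by
    show criticalCorr 3 2 ![flipAt k a, flipAt k b] = criticalCorr 3 2 ![a, b]
    rw [criticalCorr_two_pair, criticalCorr_two_pair, flipAt_sub]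
    exact twoPointPlus_reflection_invariant_holds (criticalBeta_nonneg 3) k (b - a)
  diag a := by
    show criticalCorr 3 2 ![a, a] = 1
    rw [criticalCorr_two_pair, sub_self]
    exact criticalTwoPoint_zero'
  pos a b := by
    show 0 < criticalCorr 3 2 ![a, b]
    rw [criticalCorr_two_pair]
    by_cases h : b - a = 0
    · rw [h, criticalTwoPoint_zero']; exact one_pos
    · obtain ⟨c, C, hc, hcC⟩ := criticalTwoPoint_bounds_holds (d := 3) le_rfl
      have h1 := (hcC (b - a) h).1
      exact lt_of_lt_of_le (mul_pos hc (Real.rpow_pos_of_pos (norm_pos_iff.2 h) _)) h1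
  le_one a b := by
    show criticalCorr 3 2 ![a, b] ≤ 1
    rw [criticalCorr_two_pair]; exact criticalTwoPoint_le_one' _
  upper := by
    obtain ⟨c, C, hc, hcC⟩ := criticalTwoPoint_bounds_holds (d := 3) le_rfl
    refine ⟨C, fun x hx => ?_⟩
    show criticalCorr 3 2 ![0, x] ≤ _
    rw [criticalCorr_two 3]
    have h := (hcC x hx).2
    have h32 : (-((3 : ℝ) - 2)) = -(1 : ℝ) := by norm_num
    rwa [show ((3 : ℕ) : ℝ) = (3 : ℝ) by norm_num, h32] at h
  lower := by
    obtain ⟨c, C, hc, hcC⟩ := criticalTwoPoint_bounds_holds (d := 3) le_rfl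
    refine ⟨c, hc, fun x hx => ?_⟩
    show _ ≤ criticalCorr 3 2 ![0, x]
    rw [criticalCorr_two 3]
    have h := (hcC x hx).1
    have h31 : (-((3 : ℝ) - 1)) = -(2 : ℝ) := by norm_num
    rwa [show ((3 : ℕ) : ℝ) = (3 : ℝ) by norm_num, h31] at h
  mms v w h := by
    show criticalCorr 3 2 ![0, w] ≤ criticalCorr 3 2 ![0, v]
    rw [criticalCorr_two 3, criticalCorr_two 3]
    apply twoPointPlus_le_of_mul_supNorm_le (criticalBeta_nonneg 3)
    have h' : (3 : ℝ) * (Site.supNorm v : ℝ) ≤ (Site.supNorm w : ℝ) := by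
      rwa [Site.norm_eq_supNorm, Site.norm_eq_supNorm] at h
    exact_mod_cast h'
  gks_pair a b c := by
    show criticalCorr 3 2 ![a, b] * criticalCorr 3 2 ![b, c] ≤ criticalCorr 3 2 ![a, c]
    rw [criticalCorr_two_pair, criticalCorr_two_pair, criticalCorr_two_pair]
    have h := twoPointPlus_mul_le_twoPointPlus (criticalBeta_nonneg 3) (b - a) (c - a)
    rwa [show c - a - (b - a) = c - b by abel] at h
  swap01 y := criticalCorr_comp_perm y _
  swap12 y := criticalCorr_comp_perm y _
  swap23 y := criticalCorr_comp_perm y _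
  translF y v := criticalCorr_translate y v
  coincide a x z := criticalCorr_coincide a x z
  nonneg y := criticalCorr_nonneg' y
  griffiths y := criticalCorr_griffiths y
  lebowitz y := criticalUrsellFour_nonpos (d := 3) le_rfl y
  aizenman y := by
    have h := (abs_le.1 (abs_criticalUrsellFour_le_two_mul (d := 3) le_rfl y)).1
    show -(2 * (criticalCorr 3 2 ![y 0, y 1] * criticalCorr 3 2 ![y 2, y 3])) ≤ _
    rw [← mul_assoc]
    exact h

end Summit.CriticalPhenomena.Ising3DConformalLimit.Theorems.GapForcesFarMerging.Negative

end
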